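import Literature.NumberTheory.EllipticCurves.HeegnerPoints
import Literature.NumberTheory.EllipticCurves.ModularParametrizationDegree
import Literature.NumberTheory.QuadraticFields.HeegnerCondition
import HarnessLib

/-!
# Heegner points: independence of representatives and the Heegner condition (proved)

Companion to `Literature.NumberTheory.EllipticCurves.HeegnerPoints` (named facts, D-0014). This
file contains **theorems only**: it discharges the named fact
`Literature.NumberTheory.EllipticCurves.ModularForms.heegnerPointComplex_eq_of_β_eq` — two Heegner data of level `N`, discriminant
`D` and the same residue `β (mod 2N)` give the same point `∑_{[Q]} φ(τ_Q) ∈ E(ℂ)` — from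

* the `Γ₀(N)`-invariance of the modular parametrisation `φ = Dt.φ : ℍ → E(ℂ)`
  (`ModularParametrizationData.φ_gamma0_smul_holds'`, `ModularParametrizationDegree.lean`,
  unconditional), and
* the bijection between two complete irredundant systems of representatives of the
  `Γ₀(N)`-classes of Heegner forms with `B ≡ β (mod 2N)` (each representative of one system is
  equivalent to exactly one of the other), a reindexing of the finite sum (`Finset.sum_bij`).

This is the remark "the sum does not depend on the choice of representatives" implicit in
Gross, *Heegner points on `X₀(N)`* (1984), §3 (Heegner points `(𝓞, 𝔫, [𝔞])` as points of
`X₀(N)`, i.e. `Γ₀(N)`-orbits in `ℍ`) and Gross–Zagier 1986, I.§4.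

It also discharges the named fact `Literature.NumberTheory.EllipticCurves.exists_dvd_sq_sub_discr` (**the Heegner condition**: under
the Heegner hypothesis — every `p ∣ N` splits in the imaginary quadratic field `K` — `d_K` is a
square modulo `4N`; Gross 1984, §3; Gross–Zagier 1986, I.§3) from the quadratic-field theorems of
`Literature.NumberTheory.QuadraticFields.HeegnerCondition`
(`Literature.NumberTheory.QuadraticFields.Quadratic.exists_dvd_sq_sub_discr_of_ncard_primesOver`: `√d_K ∈ 𝓞 K` reduced modulo
`𝔭ᵏ ≅ ℤ/pᵏ` at the split primes, `d_K ≡ 0, 1 (mod 4)`, Chinese remainder theorem); only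
`[K : ℚ] = 2` of `IsImaginaryQuadratic K` is used.

## Main results

* `Literature.IsGamma0Equiv.refl/symm/trans`: `Γ₀(N)`-equivalence of triples is an equivalence relation.
* `Literature.NumberTheory.EllipticCurves.HeegnerDatum.eq_of_isGamma0Equiv`: two equivalent representatives of a Heegner datum are
  equal.
* `Literature.ModularForms.heegnerPointComplex_eq_of_β_eq_holds : heegnerPointComplex_eq_of_β_eq`.
* `Literature.exists_dvd_sq_sub_discr_holds : exists_dvd_sq_sub_discr N K`.

## References

* B. H. Gross, *Heegner points on `X₀(N)`*, in *Modular Forms* (Durham 1983), Horwood (1984),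
  87–105, §3.
* B. Gross, D. Zagier, *Heegner points and derivatives of `L`-series*, Invent. Math. 84 (1986),
  I.§3–4.
* B. H. Gross, *Kolyvagin's work on modular elliptic curves*, in *`L`-functions and arithmetic*
  (Durham 1989), LMS Lecture Note Ser. 153 (1991), 235–256, §1 ("all prime factors of `N` are
  split … Choose an ideal `𝒩` of `𝒪` with `𝒪/𝒩 ≅ ℤ/Nℤ`").
-/

noncomputable section

open CongruenceSubgroup UpperHalfPlane

namespace Literature.NumberTheory.EllipticCurves

variable {N : ℕ}

/-- `Γ₀(N)`-equivalence of triples is reflexive. [folklore] -/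
theorem IsGamma0Equiv.refl (Q : ℤ × ℤ × ℤ) : IsGamma0Equiv N Q Q :=
  ⟨1, one_smul _ _⟩

/-- `Γ₀(N)`-equivalence of triples is symmetric. [folklore] -/
theorem IsGamma0Equiv.symm {Q Q' : ℤ × ℤ × ℤ} (h : IsGamma0Equiv N Q Q') : IsGamma0Equiv N Q' Q := by
  obtain ⟨γ, hγ⟩ := h
  exact ⟨γ⁻¹, by rw [← hγ, inv_smul_smul]⟩

/-- `Γ₀(N)`-equivalence of triples is transitive. [folklore] -/
theorem IsGamma0Equiv.trans {Q Q' Q'' : ℤ × ℤ × ℤ} (h : IsGamma0Equiv N Q Q')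
    (h' : IsGamma0Equiv N Q' Q'') : IsGamma0Equiv N Q Q'' := by
  obtain ⟨γ, hγ⟩ := h
  obtain ⟨γ', hγ'⟩ := h'
  exact ⟨γ' * γ, by rw [mul_smul, hγ, hγ']⟩

/-- Two `Γ₀(N)`-equivalent representatives of a Heegner datum coincide (the system of
representatives is irredundant, `HeegnerDatum.pairwise_not_isGamma0Equiv`). [folklore] -/
theorem HeegnerDatum.eq_of_isGamma0Equiv {D : ℤ} (H : HeegnerDatum N D) {Q Q' : ℤ × ℤ × ℤ}
    (hQ : Q ∈ H.reps) (hQ' : Q' ∈ H.reps) (h : IsGamma0Equiv N Q Q') : Q = Q' := by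
  by_contra hne
  exact H.pairwise_not_isGamma0Equiv hQ hQ' hne h

end Literature.NumberTheory.EllipticCurves

namespace Literature.NumberTheory.EllipticCurves.ModularForms

variable {N : ℕ} [NeZero N] {W : WeierstrassCurve ℚ}

/-- **The Heegner point does not depend on the representatives** (discharge of the named fact
`heegnerPointComplex_eq_of_β_eq`): two Heegner data of level `N`, discriminant `D` and the same
`β` give the same point `∑_{[Q]} φ(τ_Q) ∈ E(ℂ)`. Proof: every representative `Q` of `H` is
`Γ₀(N)`-equivalent to a unique representative `Q'` of `H'` (`HeegnerDatum.exists_isGamma0Equiv`,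
`HeegnerDatum.eq_of_isGamma0Equiv`), `Q ↦ Q'` is a bijection `H.reps → H'.reps`, and
`φ(τ_{Q'}) = φ(γ τ_Q) = φ(τ_Q)` by `Γ₀(N)`-invariance of `φ`
(`ModularParametrizationData.φ_gamma0_smul_holds'`) (Gross 1984, §3; Gross–Zagier 1986, I.§4).
[cite: Gross1984, §3] -/
theorem heegnerPointComplex_eq_of_β_eq_holds : heegnerPointComplex_eq_of_β_eq (N := N) (W := W) := by
  intro Dt D H H' hβ
  have hex : ∀ Q ∈ H.reps, ∃ Q' ∈ H'.reps, IsGamma0Equiv N Q Q' := fun Q hQ ↦ by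
    refine H'.exists_isGamma0Equiv Q (H.mem_heegnerForms Q hQ).1 ?_
    rw [← hβ]
    exact (H.mem_heegnerForms Q hQ).2
  choose! g hg hge using hex
  unfold heegnerPointComplex
  refine Finset.sum_bij (fun Q _ ↦ g Q) hg ?_ ?_ ?_
  · intro Q₁ h₁ Q₂ h₂ h12
    exact H.eq_of_isGamma0Equiv h₁ h₂ ((hge Q₁ h₁).trans (h12 ▸ (hge Q₂ h₂).symm))
  · intro Q' hQ'
    obtain ⟨Q, hQ, hQQ'⟩ := H.exists_isGamma0Equiv Q' (H'.mem_heegnerForms Q' hQ').1 (by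
      rw [hβ]
      exact (H'.mem_heegnerForms Q' hQ').2)
    exact ⟨Q, hQ, H'.eq_of_isGamma0Equiv (hg Q hQ) hQ' ((hge Q hQ).symm.trans hQQ'.symm)⟩
  · intro Q hQ
    obtain ⟨γ, hγ⟩ := hge Q hQ
    rw [← hγ]
    exact (Dt.φ_gamma0_smul_holds' γ _).symm

end Literature.NumberTheory.EllipticCurves.ModularForms

/-! ### The Heegner condition `d_K ≡ β² (mod 4N)` -/

namespace Literature.NumberTheory.EllipticCurves

universe u

/-- **Discharge of `Literature.NumberTheory.EllipticCurves.exists_dvd_sq_sub_discr` (the Heegner condition).** Under the Heegner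
hypothesis for `(N, K)`, `K` imaginary quadratic, the discriminant `d_K` is a square modulo `4N`:
`4N ∣ β² − d_K` for some `β ∈ ℤ`. Each `p ∣ N` has two primes `𝔭, 𝔭'` of `𝓞 K` above it, so
`e = f = 1` and `𝓞 K/𝔭ᵏ ≅ ℤ/pᵏ`; reducing `δ = √d_K ∈ 𝓞 K` (`δ = 2ω − t` for an integral
basis `(1, ω)`, `ω² = m + tω`, `d_K = t² + 4m`) modulo `𝔭ᵏ` makes `d_K` a square modulo `pᵏ`;
at `p = 2 ∤ N`, `d_K ≡ t² (mod 4)`; the Chinese remainder theorem glues these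
(`Literature.NumberTheory.QuadraticFields.Quadratic.exists_dvd_sq_sub_discr_of_ncard_primesOver`). Only `[K : ℚ] = 2` is used.
This is the solvability of `D ≡ β² (mod 4N)` under "all prime factors of `N` are split" of
Gross 1984, §3 and Gross–Zagier 1986, I.§3 (equivalently the ideal `𝔫 = (N, (β + √D)/2)` with
`𝓞/𝔫 ≅ ℤ/Nℤ` of Gross 1991, §1, for which see
`Literature.NumberTheory.QuadraticFields.Quadratic.exists_ideal_quotient_ringEquiv_zmod_of_ncard_eq_two`). [cite: Gross1984, §3] -/
theorem exists_dvd_sq_sub_discr_holds (N : ℕ) [NeZero N] (K : Type u) [Field K] [NumberField K] :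
    exists_dvd_sq_sub_discr N K := fun hK hH ↦
  Literature.NumberTheory.QuadraticFields.Quadratic.exists_dvd_sq_sub_discr_of_ncard_primesOver hK.1 (NeZero.ne N) hH

end Literature.NumberTheory.EllipticCurves

end
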